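import Literature.Probability.RandomPlanarGeometry.SAWTriangularDetourSurgery
import HarnessLib

/-!
# The double transfer `Σ_ω I(ω)(I(ω)−8)₊/((J(ω)+3)(J(ω)+6)) ≤ c_{N+2}(𝕋)` (Madras–Slade (7.3.7), one-step detour variant)

Topic `Literature/Probability/RandomPlanarGeometry` (continues `SAWTriangularDetourSurgery.lean`: the triangular-lattice detour surgery
`triIns`/`triDel`, the slot and sharp-turn counts `triSlots` (`I`) / `triSharp` (`J`), the pair bijection
`sum_triSlotPairs_eq_sum_triSharpPairs`, and the bounded bookkeeping `1 ≤ J' ≤ J + 3`, `I ≤ I' + 8`).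

Source: N. Madras, G. Slade, *The Self-Avoiding Walk* (1993), proof of Theorem 7.3.2, eq. (7.3.7) (p. 245): the LOWER bound for the
count two surgeries on, obtained by counting pairs (walk, surgery site) twice; here for the ONE-step detour insertion on the
triangular lattice `𝕋` (the modification announced on p. 244, "we can modify our argument easily", never written out), with the
inexact bookkeeping of `SAWTriangularDetourSurgery` in place of the printed exact counts — the `𝕋` twin of the tree's
`KestenHairpin.sum_le_count_add_four` (hairpins on `ℤ^d`).  Lane «pcv-sawmu» TRI-RATIO, piece K2, block (P2) (a-p5's partition;
face `triKesten_P2` frozen 2026-08-22).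

## What is here (namespace `Literature.Probability.RandomPlanarGeometry.SAW`; all proved, axioms standard)

* `sum_card_triSlots_div_le_triSawCount` — level `N+1`: `Σ_{ω' ∈ S_{N+1}(𝕋)} I(ω')/(J(ω')+3) ≤ c_{N+2}(𝕋)`;
* **`triKesten_P2`** — `Σ_{ω ∈ S_N(𝕋)} I(ω)·max(0, I(ω)−8)/((J(ω)+3)(J(ω)+6)) ≤ c_{N+2}(𝕋)`.
-/

noncomputable section

open Finset
open Literature.Probability.LatticeModels Literature.Probability.Percolation SimpleGraph

namespace Literature.Probability.RandomPlanarGeometry.SAW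

/-! ## (P2) The double transfer: a lower bound for `c_{N+2}(𝕋)` (Madras–Slade (7.3.7), one-step detour variant)

Lane «pcv-sawmu» TRI-RATIO, piece K2 block (P2) (a-p5's partition): the `𝕋` twin of the tree's
`KestenHairpin.sum_le_count_add_four` with the detour insertion `triIns` in place of the hairpin swap and the inexact
bookkeeping `1 ≤ J' ≤ J + 3`, `I ≤ I' + 8` of `SAWTriangularDetourSurgery`. -/

section DoubleTransfer

/-- **Level `N+1` (single step of (7.3.7))**: `Σ_{ω' ∈ S_{N+1}} I(ω')/(J(ω')+3) ≤ c_{N+2}(𝕋)` — each slot pair `(ω', s)` is sent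
to the sharp-turn pair `(triIns s ω', ·)`, a walk `ω''` of `S_{N+2}` receiving exactly `J(ω'')` of them, and
`J(triIns s ω') ≤ J(ω') + 3`. [cite: MadrasSlade1993, Theorem 7.3.2 (proof), eq. (7.3.7)] -/
theorem sum_card_triSlots_div_le_triSawCount (N : ℕ) :
    ∑ ω ∈ triSL (N + 1), (#(triSlots ω) : ℝ) / ((#(triSharp ω) : ℝ) + 3) ≤ (triSawCount (N + 2) : ℝ) := by
  classical
  have e1 : ∑ ω ∈ triSL (N + 1), (#(triSlots ω) : ℝ) / ((#(triSharp ω) : ℝ) + 3) =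
      ∑ p ∈ triSlotPairs (N + 1), 1 / ((#(triSharp p.1) : ℝ) + 3) := by
    rw [sum_triSlotPairs (N + 1) (fun ω => 1 / ((#(triSharp ω) : ℝ) + 3))]
    exact sum_congr rfl fun ω _ => by rw [mul_one_div]
  have e2 : ∑ p ∈ triSlotPairs (N + 1), 1 / ((#(triSharp p.1) : ℝ) + 3) ≤
      ∑ p ∈ triSlotPairs (N + 1), 1 / (#(triSharp (triIns p.2.1 p.2.2 p.1)) : ℝ) := by
    refine sum_le_sum fun p hp => ?_
    rw [triSlotPairs, Finset.mem_sigma] at hp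
    obtain ⟨hω, hs⟩ := hp
    have hs' : (p.2.1, p.2.2) ∈ triSlots p.1 := hs
    have hJ1 := one_le_card_triSharp_triIns hω hs'
    obtain ⟨hm, -, -, -⟩ := mem_triSlots.1 hs'
    have hJ3 := card_triSharp_triIns_le (z := p.2.2) (ω := p.1) (m := p.2.1) (by omega)
    have hpos : (0 : ℝ) < #(triSharp (triIns p.2.1 p.2.2 p.1)) := by exact_mod_cast hJ1
    apply one_div_le_one_div_of_le hpos
    exact_mod_cast hJ3
  have e3 : ∑ p ∈ triSlotPairs (N + 1), 1 / (#(triSharp (triIns p.2.1 p.2.2 p.1)) : ℝ) =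
      ∑ q ∈ triSharpPairs (N + 1 + 1), 1 / (#(triSharp q.1) : ℝ) :=
    sum_triSlotPairs_eq_sum_triSharpPairs (N + 1) _ (fun q => 1 / (#(triSharp q.1) : ℝ)) fun p _ => rfl
  have e4 : ∑ q ∈ triSharpPairs (N + 1 + 1), 1 / (#(triSharp q.1) : ℝ) ≤ (triSawCount (N + 2) : ℝ) := by
    rw [sum_triSharpPairs (N + 1 + 1) (fun ω => 1 / (#(triSharp ω) : ℝ)), show N + 2 = N + 1 + 1 by ring,
      ← card_triSL, Finset.card_eq_sum_ones, Nat.cast_sum]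
    refine sum_le_sum fun ω _ => ?_
    by_cases h : #(triSharp ω) = 0
    · rw [h]; simp
    · rw [mul_one_div_cancel (by exact_mod_cast h)]; simp
  rw [e1]
  exact e2.trans (e3.le.trans e4)

/-- **(P2) The double transfer (Madras–Slade (7.3.7), one-step detour variant on `𝕋`)**:
`Σ_{ω ∈ S_N(𝕋)} I(ω) · max(0, I(ω) − 8) / ((J(ω)+3)(J(ω)+6)) ≤ c_{N+2}(𝕋)`, `I = #triSlots`, `J = #triSharp` — two detour
insertions, counted through the slot-pair/sharp-pair bijection twice, with the bookkeeping `1 ≤ J' ≤ J + 3` and `I ≤ I' + 8`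
of `SAWTriangularDetourSurgery`. [cite: MadrasSlade1993, Theorem 7.3.2 (proof), eq. (7.3.7) (p. 245)] -/
theorem triKesten_P2 (N : ℕ) :
    ∑ ω ∈ triSL N, (#(triSlots ω) : ℝ) * max 0 ((#(triSlots ω) : ℝ) - 8) /
        (((#(triSharp ω) : ℝ) + 3) * ((#(triSharp ω) : ℝ) + 6)) ≤ (triSawCount (N + 2) : ℝ) := by
  classical
  refine le_trans ?_ (sum_card_triSlots_div_le_triSawCount N)
  -- level `N`: the weight `g(ω') = I'/((J'+3) J')`, so that `J' · g(ω') = I'/(J'+3)` when `J' ≥ 1`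
  set g : List (Site 2) → ℝ := fun ω' =>
    (#(triSlots ω') : ℝ) / (((#(triSharp ω') : ℝ) + 3) * (#(triSharp ω') : ℝ)) with hg
  have hB : ∑ ω' ∈ triSL (N + 1), (#(triSharp ω') : ℝ) * g ω' ≤
      ∑ ω' ∈ triSL (N + 1), (#(triSlots ω') : ℝ) / ((#(triSharp ω') : ℝ) + 3) := by
    refine sum_le_sum fun ω' _ => ?_
    by_cases h : #(triSharp ω') = 0
    · rw [h]; simp only [Nat.cast_zero, zero_mul, zero_add]; positivity
    · have hpos : (0 : ℝ) < #(triSharp ω') := by exact_mod_cast Nat.pos_of_ne_zero h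
      rw [hg]
      rw [show (#(triSharp ω') : ℝ) * ((#(triSlots ω') : ℝ) /
          (((#(triSharp ω') : ℝ) + 3) * (#(triSharp ω') : ℝ))) =
          (#(triSlots ω') : ℝ) / ((#(triSharp ω') : ℝ) + 3) by field_simp]
  refine le_trans ?_ hB
  rw [← sum_triSharpPairs (N + 1) g]
  rw [← sum_triSlotPairs_eq_sum_triSharpPairs N (fun p => g (triIns p.2.1 p.2.2 p.1)) (fun q => g q.1) fun p _ => rfl]
  rw [show ∑ ω ∈ triSL N, (#(triSlots ω) : ℝ) * max 0 ((#(triSlots ω) : ℝ) - 8) /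
      (((#(triSharp ω) : ℝ) + 3) * ((#(triSharp ω) : ℝ) + 6)) =
      ∑ ω ∈ triSL N, (#(triSlots ω) : ℝ) * (max 0 ((#(triSlots ω) : ℝ) - 8) /
      (((#(triSharp ω) : ℝ) + 3) * ((#(triSharp ω) : ℝ) + 6))) from
    sum_congr rfl fun ω _ => by rw [mul_div_assoc]]
  rw [← sum_triSlotPairs N (fun ω => max 0 ((#(triSlots ω) : ℝ) - 8) /
      (((#(triSharp ω) : ℝ) + 3) * ((#(triSharp ω) : ℝ) + 6)))]
  refine sum_le_sum fun p hp => ?_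
  rw [triSlotPairs, Finset.mem_sigma] at hp
  obtain ⟨hω, hs⟩ := hp
  have hs' : (p.2.1, p.2.2) ∈ triSlots p.1 := hs
  obtain ⟨hm, -, -, -⟩ := mem_triSlots.1 hs'
  set ω' := triIns p.2.1 p.2.2 p.1 with hω'
  have hJ1 : (1 : ℝ) ≤ #(triSharp ω') := by exact_mod_cast one_le_card_triSharp_triIns hω hs'
  have hJ3 : (#(triSharp ω') : ℝ) ≤ #(triSharp p.1) + 3 := by
    exact_mod_cast card_triSharp_triIns_le (z := p.2.2) (ω := p.1) (m := p.2.1) (by omega)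
  have hI : (#(triSlots p.1) : ℝ) ≤ #(triSlots ω') + 8 := by
    exact_mod_cast card_triSlots_le_triIns hω hs'
  have hJ0 : (0 : ℝ) ≤ #(triSharp p.1) := Nat.cast_nonneg _
  have hI0 : (0 : ℝ) ≤ #(triSlots ω') := Nat.cast_nonneg _
  show max 0 ((#(triSlots p.1) : ℝ) - 8) / (((#(triSharp p.1) : ℝ) + 3) * ((#(triSharp p.1) : ℝ) + 6)) ≤ g ω'
  rw [hg]; simp only
  have hden : ((#(triSharp ω') : ℝ) + 3) * (#(triSharp ω') : ℝ) ≤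
      ((#(triSharp p.1) : ℝ) + 3) * ((#(triSharp p.1) : ℝ) + 6) := by nlinarith
  have hden0 : 0 < ((#(triSharp ω') : ℝ) + 3) * (#(triSharp ω') : ℝ) := by positivity
  rcases le_or_gt ((#(triSlots p.1) : ℝ) - 8) 0 with hneg | hpos
  · rw [max_eq_left hneg, zero_div]
    exact div_nonneg hI0 hden0.le
  · rw [max_eq_right hpos.le]
    calc ((#(triSlots p.1) : ℝ) - 8) / (((#(triSharp p.1) : ℝ) + 3) * ((#(triSharp p.1) : ℝ) + 6))
        ≤ ((#(triSlots p.1) : ℝ) - 8) / (((#(triSharp ω') : ℝ) + 3) * (#(triSharp ω') : ℝ)) :=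
          div_le_div_of_nonneg_left hpos.le hden0 hden
      _ ≤ (#(triSlots ω') : ℝ) / (((#(triSharp ω') : ℝ) + 3) * (#(triSharp ω') : ℝ)) :=
          div_le_div_of_nonneg_right (by linarith) hden0.le

end DoubleTransfer

end Literature.Probability.RandomPlanarGeometry.SAW
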